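import Summits.RiemannHypothesis.RiemannHypothesis.Theorems.Splittings.SplitXWucK1RK
import HarnessLib

/-!
# Splittings — x-wuc GEN-11 `SplitXWucK1R` (K1′(ℝ) AT THE STAKE) — mechanical carve part 12/14
Continuation of `Summits.RiemannHypothesis.RiemannHypothesis.Theorems.Splittings.SplitXWucK1RK`: byte-identical declaration units of the referee-passed extract `SplitXWucK1R.lean`
sha16 70c8eb2af2868881 (x-wuc g11; ref g10 PASS 2026-08-27T22:59:46Z; RULING #330); open namespaces/sections re-opened with their context.
HONEST LABEL: splitting search over kernel-typed RH-equivalences; K-CERT′ (complex `f`) stays OPEN; nothing here bears on the truth of RH.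
-/
set_option linter.dupNamespace false
noncomputable section
open scoped Classical ComplexConjugate
open Set Filter Topology Complex MeasureTheory
open Real Set Filter Topology
open Real Set MeasureTheory Complex Filter Topology
open scoped Real
namespace Summit.RiemannHypothesis.RiemannHypothesis.Theorems.Splittings.XWucG8.DSLine
open scoped ComplexConjugate
/-- the dent-tail factor: `κ sinh κ ≤ 4 (cosh κ − sinh κ/κ)` for `0 < κ ≤ 1` — so the local dent §G11i is bounded by
`(cosh κ − sinh κ/κ)·(Mloc + 4τ(M − Mloc))`. -/
theorem kappa_sinh_le_four_dent {κ : ℝ} (hκ : 0 < κ) (hκ1 : κ ≤ 1) :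
    κ * Real.sinh κ ≤ 4 * (Real.cosh κ - Real.sinh κ / κ) := by
  -- φ(y) = 4y cosh y − (4 + y²) sinh y is nondecreasing on [0, 1] (φ' = y(2 sinh y − y cosh y) ≥ 0), φ(0) = 0.
  have hderiv : ∀ x : ℝ, HasDerivAt (fun y : ℝ => 4 * y * Real.cosh y - (4 + y ^ 2) * Real.sinh y)
      (x * (2 * Real.sinh x - x * Real.cosh x)) x := by
    intro x
    have h1 : HasDerivAt (fun y : ℝ => 4 * y) 4 x := by
      simpa using (hasDerivAt_id x).const_mul (4 : ℝ)
    have h2 : HasDerivAt (fun y : ℝ => 4 + y ^ 2) (2 * x) x := by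
      simpa using (hasDerivAt_pow 2 x).const_add (4 : ℝ)
    have h := (h1.mul (Real.hasDerivAt_cosh x)).sub (h2.mul (Real.hasDerivAt_sinh x))
    exact h.congr_deriv (by ring)
  have hmono : MonotoneOn (fun y : ℝ => 4 * y * Real.cosh y - (4 + y ^ 2) * Real.sinh y) (Icc 0 1) := by
    apply monotoneOn_of_deriv_nonneg (convex_Icc 0 1) (by fun_prop : Continuous _).continuousOn
    · exact fun x _ => (hderiv x).differentiableAt.differentiableWithinAt
    · intro x hx
      rw [interior_Icc] at hx
      rw [(hderiv x).deriv]
      have hx0 : 0 ≤ x := hx.1.le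
      have hs : x ≤ Real.sinh x := Real.self_le_sinh_iff.mpr hx0
      have hc : Real.cosh x ≤ 2 := by
        have h1 : Real.cosh x ≤ Real.cosh 1 := by
          rw [Real.cosh_le_cosh, abs_of_nonneg hx0, abs_one]; exact hx.2.le
        linarith [show Real.cosh 1 ≤ 2 by rw [Real.cosh_eq, Real.exp_neg]; linarith [Real.exp_one_lt_d9, Real.exp_one_gt_d9, inv_le_one_of_one_le₀ (show (1:ℝ) ≤ Real.exp 1 by linarith [Real.exp_one_gt_d9])]]
      have : 0 ≤ 2 * Real.sinh x - x * Real.cosh x := by nlinarith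
      exact mul_nonneg hx0 this
  have h := hmono (show (0 : ℝ) ∈ Icc (0 : ℝ) 1 from ⟨le_refl _, zero_le_one⟩) ⟨hκ.le, hκ1⟩ hκ.le
  simp only [mul_zero, zero_mul, Real.sinh_zero, sub_zero] at h
  -- h : 0 ≤ 4 κ cosh κ − (4 + κ²) sinh κ
  have e : κ * (Real.sinh κ / κ) = Real.sinh κ := by field_simp
  have key : κ * (κ * Real.sinh κ) ≤ κ * (4 * (Real.cosh κ - Real.sinh κ / κ)) := by
    have e2 : κ * (4 * (Real.cosh κ - Real.sinh κ / κ)) = 4 * κ * Real.cosh κ - 4 * (κ * (Real.sinh κ / κ)) := by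
      ring
    rw [e2, e]
    have e3 : κ * (κ * Real.sinh κ) = κ ^ 2 * Real.sinh κ := by ring
    rw [e3]
    linarith [h]
  exact le_of_mul_le_mul_left key hκ

end Summit.RiemannHypothesis.RiemannHypothesis.Theorems.Splittings.XWucG8.DSLine
namespace Summit.RiemannHypothesis.RiemannHypothesis.Theorems.Splittings.XWucG8
end Summit.RiemannHypothesis.RiemannHypothesis.Theorems.Splittings.XWucG8
open Real Set MeasureTheory Complex Filter Topology
open scoped Real
namespace Summit.RiemannHypothesis.RiemannHypothesis.Theorems.Splittings.XWucG8.DSLine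
/-- radius pigeonhole. -/
theorem exists_ratio_step {J : ℕ} {η : ℝ} (hη : 0 ≤ η) (u : ℕ → ℝ) (hu : ∀ k, 0 ≤ u k)
    (hJ : u J < (1 + J * η) * u 0) : ∃ k : ℕ, k < J ∧ u (k + 1) ≤ (1 + η) * u k := by
  by_contra hcon
  simp only [not_exists, not_and, not_le] at hcon
  have hind : ∀ k : ℕ, k ≤ J → (1 + η) ^ k * u 0 ≤ u k := by
    intro k
    induction k with
    | zero => intro _; simp
    | succ n ih =>
        intro hn
        have h1 := ih (Nat.le_of_succ_le hn)
        have h2 := hcon n (Nat.lt_of_succ_le hn)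
        calc (1 + η) ^ (n + 1) * u 0 = (1 + η) * ((1 + η) ^ n * u 0) := by ring
          _ ≤ (1 + η) * u n := mul_le_mul_of_nonneg_left h1 (by linarith)
          _ ≤ u (n + 1) := h2.le
  have hB : 1 + (J : ℝ) * η ≤ (1 + η) ^ J := one_add_mul_le_pow (by linarith) J
  have h3 := mul_le_mul_of_nonneg_right hB (hu 0)
  have h4 := hind J le_rfl
  linarith

/-- `continuous_tfT_zero` — helper of the x-wuc GEN-11 chain «K1′(ℝ) at the stake» (verbatim from the referee-passed extract `SplitXWucK1R.lean` 70c8eb2af2868881; role: see the module docstring). -/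
theorem continuous_tfT_zero (g : ℝ → ℂ) (hg : Continuous g) : Continuous (fun y : ℝ => tfT g y 0) :=
  continuous_iff_continuousAt.mpr fun y => (hasDerivAt_tfT g hg y).continuousAt

/-- the max of `‖T_g(·,0)‖` on `[−ρ, ρ]`. -/
noncomputable def supOn (g : ℝ → ℂ) (ρ : ℝ) : ℝ := sSup ((fun y : ℝ => ‖tfT g y 0‖) '' Icc (-ρ) ρ)

/-- `le_supOn` — helper of the x-wuc GEN-11 chain «K1′(ℝ) at the stake» (verbatim from the referee-passed extract `SplitXWucK1R.lean` 70c8eb2af2868881; role: see the module docstring). -/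
theorem le_supOn (g : ℝ → ℂ) (hg : Continuous g) {ρ y : ℝ} (hy : |y| ≤ ρ) : ‖tfT g y 0‖ ≤ supOn g ρ := by
  have hc : ContinuousOn (fun y : ℝ => ‖tfT g y 0‖) (Icc (-ρ) ρ) :=
    ((continuous_tfT_zero g hg).norm).continuousOn
  have hb : BddAbove ((fun y : ℝ => ‖tfT g y 0‖) '' Icc (-ρ) ρ) := isCompact_Icc.bddAbove_image hc
  exact le_csSup hb (mem_image_of_mem _ (mem_Icc.mpr (abs_le.mp hy)))

/-- `exists_eq_supOn` — helper of the x-wuc GEN-11 chain «K1′(ℝ) at the stake» (verbatim from the referee-passed extract `SplitXWucK1R.lean` 70c8eb2af2868881; role: see the module docstring). -/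
theorem exists_eq_supOn (g : ℝ → ℂ) (hg : Continuous g) {ρ : ℝ} (hρ : 0 ≤ ρ) :
    ∃ c : ℝ, |c| ≤ ρ ∧ ‖tfT g c 0‖ = supOn g ρ := by
  have hc : ContinuousOn (fun y : ℝ => ‖tfT g y 0‖) (Icc (-ρ) ρ) :=
    ((continuous_tfT_zero g hg).norm).continuousOn
  have hne : (Icc (-ρ) ρ).Nonempty := ⟨0, mem_Icc.mpr ⟨by linarith, hρ⟩⟩
  obtain ⟨c, hcmem, hceq⟩ := isCompact_Icc.exists_sSup_image_eq hne hc
  exact ⟨c, abs_le.mpr (mem_Icc.mp hcmem), hceq.symm⟩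

/-- `supOn_nonneg` — helper of the x-wuc GEN-11 chain «K1′(ℝ) at the stake» (verbatim from the referee-passed extract `SplitXWucK1R.lean` 70c8eb2af2868881; role: see the module docstring). -/
theorem supOn_nonneg (g : ℝ → ℂ) (hg : Continuous g) {ρ : ℝ} (hρ : 0 ≤ ρ) : 0 ≤ supOn g ρ :=
  le_trans (norm_nonneg _) (le_supOn g hg (show |(0 : ℝ)| ≤ ρ by rw [abs_zero]; exact hρ))

/-- `supOn_mono` — helper of the x-wuc GEN-11 chain «K1′(ℝ) at the stake» (verbatim from the referee-passed extract `SplitXWucK1R.lean` 70c8eb2af2868881; role: see the module docstring). -/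
theorem supOn_mono (g : ℝ → ℂ) (hg : Continuous g) {ρ ρ' : ℝ} (hρ : 0 ≤ ρ) (h : ρ ≤ ρ') :
    supOn g ρ ≤ supOn g ρ' := by
  obtain ⟨c, hc, hceq⟩ := exists_eq_supOn g hg hρ
  rw [← hceq]
  exact le_supOn g hg (hc.trans h)

/-- `supOn_le` — helper of the x-wuc GEN-11 chain «K1′(ℝ) at the stake» (verbatim from the referee-passed extract `SplitXWucK1R.lean` 70c8eb2af2868881; role: see the module docstring). -/
theorem supOn_le (g : ℝ → ℂ) (hg : Continuous g) {ρ M : ℝ} (hρ : 0 ≤ ρ) (hM : ∀ y : ℝ, ‖tfT g y 0‖ ≤ M) :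
    supOn g ρ ≤ M := by
  obtain ⟨c, _, hceq⟩ := exists_eq_supOn g hg hρ
  rw [← hceq]; exact hM c

/-- `‖T_g(y,0)‖ ≤ √(2∫‖g‖²)` (one term of Parseval). -/
theorem norm_tfT_le_sqrt_energy (g : ℝ → ℂ) (hg : Continuous g) (y : ℝ) :
    ‖tfT g y 0‖ ≤ Real.sqrt (2 * ∫ u in Icc (-1 : ℝ) 1, ‖g u‖ ^ 2) := by
  have h := sum_norm_sq_tfT_le_cosh_sq g hg y 0 {0}
  simp only [Finset.sum_singleton, Int.cast_zero, mul_zero, add_zero, Real.cosh_zero, one_pow, mul_one] at h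
  have h2 := Real.abs_le_sqrt h
  rwa [abs_of_nonneg (norm_nonneg _)] at h2

/-- a near-maximiser of a transform vanishing at `0` sits at `|c| ≥ π/2 − a₀`. -/
theorem nearmax_far_local (g : ℝ → ℂ) (hg : Continuous g) {c m Mx : ℝ} (hm : 0 < m) (hMx : 0 < Mx)
    (hDSloc : ∀ y : ℝ, |y - c| ≤ π → ∀ w : ℂ, ‖w‖ ≤ 1 →
      (w * tfT g y 0).re ^ 2 + (w * tfT₁ g y).re ^ 2 ≤ Mx ^ 2)
    (hat : ‖tfT g c 0‖ = m) (h0 : tfT g 0 0 = 0) (ha : Real.arccos (m / Mx) < π / 2) :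
    π / 2 - Real.arccos (m / Mx) ≤ |c| := by
  by_contra hlt
  rw [not_le] at hlt
  have hA0 := Real.arccos_nonneg (m / Mx)
  have hca := abs_nonneg c
  have ht : |(-c)| ≤ π := by rw [abs_neg]; linarith
  have hta : Real.arccos (m / Mx) + |(-c)| ≤ π := by rw [abs_neg]; linarith
  have h := lobe_at_nearmax_local g hg hm hMx hDSloc hat ht hta
  rw [add_neg_cancel, h0, norm_zero, abs_neg] at h
  have hpos : 0 < Real.cos (Real.arccos (m / Mx) + |c|) :=
    Real.cos_pos_of_mem_Ioo ⟨by linarith, by linarith⟩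
  linarith [mul_pos hMx hpos]

/-- the defect angle: `1 − 9·10⁻⁵ ≤ q ≤ 1 ⇒ arccos q ≤ 0.0142`. -/
theorem arccos_le_of_ge {q : ℝ} (hq1 : q ≤ 1) (hq : 1 - 9 / 100000 ≤ q) : Real.arccos q ≤ 142 / 10000 := by
  by_contra hcon
  rw [not_le] at hcon
  set a := Real.arccos q with ha
  have hcos : Real.cos a = q := Real.cos_arccos (by linarith) hq1
  have haπ : a ≤ π := Real.arccos_le_pi q
  have ha0 : 0 ≤ a := Real.arccos_nonneg q
  rw [← hcos] at hq
  have hb1 : Real.cos 1 ≤ 1 - 43 / 96 := by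
    have h := Real.cos_bound (show |(1 : ℝ)| ≤ 1 by rw [abs_one])
    rw [abs_one, one_pow] at h
    have := (abs_le.mp h).2
    linarith
  rcases le_or_gt a 1 with h1 | h1
  · have h := Real.cos_bound (show |a| ≤ 1 by rwa [abs_of_nonneg ha0])
    rw [abs_of_nonneg ha0] at h
    have h2 := (abs_le.mp h).2
    have ha2 : a ^ 2 ≤ 1 := pow_le_one₀ ha0 h1
    have h4 : a ^ 4 ≤ a ^ 2 := by
      have e : a ^ 4 = a ^ 2 * a ^ 2 := by ring
      rw [e]
      exact le_trans (mul_le_mul_of_nonneg_left ha2 (sq_nonneg a)) (le_of_eq (mul_one _))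
    have h6 : Real.cos a ≤ 1 - 43 / 96 * a ^ 2 := by linarith [h2, h4]
    have h5 : (142 / 10000 : ℝ) ^ 2 < a ^ 2 := by nlinarith [hcon, ha0]
    linarith [h6, h5, hq]
  · have h3 : Real.cos a ≤ Real.cos 1 := Real.cos_le_cos_of_nonneg_of_le_pi (by norm_num) haπ h1.le
    linarith [hq, hb1, h3]

/-- band arithmetic: `1.1225·10⁹·D ≤ e^{2πD}/4` once `2πD ≥ 23.8095` (i.e. `2π·0.042·D ≥ 1`). -/
theorem exp_band {D : ℝ} (hD : 238095 / 10000 ≤ 2 * Real.pi * D) :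
    11225 * 10 ^ 5 * D ≤ Real.exp (2 * Real.pi * D) / 4 := by
  have hE : (97448 : ℝ) * 10 ^ 5 ≤ Real.exp 23 := by
    have h1 := Real.exp_one_gt_d9
    have h2 : Real.exp 23 = Real.exp 1 ^ 23 := by rw [← Real.exp_nat_mul]; norm_num
    rw [h2]
    have h3 : (2.7182818283 : ℝ) ^ 23 ≤ Real.exp 1 ^ 23 := pow_le_pow_left₀ (by norm_num) h1.le 23
    have h4 : (97448 : ℝ) * 10 ^ 5 ≤ (2.7182818283 : ℝ) ^ 23 := by norm_num
    linarith
  set y := 2 * Real.pi * D - 23 with hy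
  have hy1 : 8095 / 10000 ≤ y := by linarith
  have hy0 : 0 ≤ y := by linarith
  have h5 : 1 + y + y ^ 2 / 2 ≤ Real.exp y := Real.quadratic_le_exp_of_nonneg hy0
  have h6 : Real.exp (2 * Real.pi * D) = Real.exp 23 * Real.exp y := by
    rw [← Real.exp_add]; congr 1; ring
  rw [h6]
  have hπ := Real.pi_gt_d6
  have hDy : D * (6283184 / 1000000) ≤ 23 + y := by rw [hy]; nlinarith
  have h7 : (97448 : ℝ) * 10 ^ 5 * (1 + y + y ^ 2 / 2) ≤ Real.exp 23 * Real.exp y :=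
    mul_le_mul hE h5 (by positivity) (Real.exp_pos 23).le
  nlinarith [h7, hDy, hy1]

end Summit.RiemannHypothesis.RiemannHypothesis.Theorems.Splittings.XWucG8.DSLine
namespace Summit.RiemannHypothesis.RiemannHypothesis.Theorems.Splittings.XWucG8
end Summit.RiemannHypothesis.RiemannHypothesis.Theorems.Splittings.XWucG8
namespace Summit.RiemannHypothesis.RiemannHypothesis.Theorems.Splittings.XWucG8.DSLine
open scoped ComplexConjugate
/-- shrunk left endpoints: lobes at `c` and `−c`, half-width `π/2 − y_j − a`. -/
noncomputable def aWd (c a : ℝ) : Fin (16 + 16) → ℝ :=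
  Fin.append (fun j : Fin 16 => c - (π / 2 - yN j - a)) (fun j : Fin 16 => -c - (π / 2 - yN j - a))

/-- shrunk right endpoints. -/
noncomputable def bWd (c a : ℝ) : Fin (16 + 16) → ℝ :=
  Fin.append (fun j : Fin 16 => c + (π / 2 - yN j - a)) (fun j : Fin 16 => -c + (π / 2 - yN j - a))

end Summit.RiemannHypothesis.RiemannHypothesis.Theorems.Splittings.XWucG8.DSLine
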